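import Summits.RiemannHypothesis.RiemannHypothesis.Theorems.MotivicDoorDiagonalAsymptotics
import HarnessLib

/-!
# Motivic door (Connes–Consani): the archimedean residual to second order

Honest framing (cell `pub-rhdoor`, cc-3, verbatim): "lottery ticket at the motivic door; RH
probability negligible; consolation prizes are real: a new semi-local Weil-positivity theorem, or a
located gap in the Connes–Consani programme, plus the ff-door theorem".  No RH content below;
value = theorem.

`MotivicDoorDiagonalAsymptotics` proved the dilation law of the archimedean functional
`W_arch = weilArchTerm` (`= −W_ℝ` in the sign convention of Bombieri 2000, Thm 2): for a Weil test
`F`, `k = weilSymm F = F + F(−·)`, `𝓔 = logLaplacianEnergy`,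
`W_arch(F(E·)) = F(0) log E + (½𝓔(F) − log(2π)F(0)) + ½∫₀^∞ k_r(x) k(Ex) dx`,
with the residual kernel `k_r(x) = 1/x − e^{x/2}/sinh x = archResidualKernel x` bounded, whence an
`O(1)` third term.  This file computes that term to the next order.

PROVED (RH-free, Suzuki-free):
* `abs_archResidualKernel_add_half_le`: `|k_r(x) + ½| ≤ x/4` on `(0, 1]`;
  `tendsto_archResidualKernel_nhdsGT_zero`: `k_r(0⁺) = −½` (the value recorded without proof in
  `MotivicDoorArchLogLaplacian`).
* `norm_archResidual_comp_mul_add_le`: for `supp F ⊆ [-S, S]`, `S ≤ E`: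
  `‖½∫₀^∞ k_r(x) k(Ex) dx + (4E)⁻¹∫₀^∞ k‖ ≤ S/(8E²) · ∫₀^∞‖k‖`.
* `norm_weilArchTerm_comp_mul_sub_three_le`: the THREE-term dilation law
  `W_arch(F(E·)) = F(0) log E + (½𝓔(F) − log(2π)F(0)) − (4E)⁻¹∫₀^∞ k + O(S E⁻² ∫₀^∞‖k‖)`.
* `integral_Ioi_weilSymm_eq_integral`, `integral_Ioi_weilSymm_weilConv_weilReflect`:
  `∫₀^∞ k = ∫_ℝ F`, and `= |∫g|²` for `F = g ⋆ g̃`.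

Used by `MotivicDoorDiagonalConstant` (the constant term `¼(∫u)²` of the decreed diagonal).
References: Bombieri 2000 (Thm 2); Connes, arXiv:1509.05576 §4.1; Connes–Consani,
arXiv:1805.10501 §3.
-/

noncomputable section

set_option linter.dupNamespace false

open Complex Set MeasureTheory Filter Topology Literature.NumberTheory.LFunctions
open Literature.NumberTheory.ConnesConsani2019
open Summit.RiemannHypothesis.RiemannHypothesis.Theorems.MotivicDoor.ArchLogLaplacian

namespace Summit.RiemannHypothesis.RiemannHypothesis.Theorems.MotivicDoor.ConnesConsani

/-! ## 1. The residual kernel at `0⁺`: `k_r(x) = −½ + O(x)` -/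

section Kernel

/-- Taylor bound for `exp` on `[-1, 1]` to third order:
`|e^y − (1 + y + y²/2 + y³/6)| ≤ (5/96) y⁴` (`Real.exp_bound`, `n = 4`). -/
theorem abs_exp_sub_taylor_three_le {y : ℝ} (hy : |y| ≤ 1) :
    |Real.exp y - (1 + y + y ^ 2 / 2 + y ^ 3 / 6)| ≤ 5 / 96 * y ^ 4 := by
  have h := Real.exp_bound hy (n := 4) (by norm_num)
  have e : ∑ m ∈ Finset.range 4, y ^ m / (m.factorial : ℝ) = 1 + y + y ^ 2 / 2 + y ^ 3 / 6 := by
    simp [Finset.sum_range_succ, Nat.factorial]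
  have e4 : |y| ^ 4 = y ^ 4 := by rw [← abs_pow]; exact abs_of_nonneg (by positivity)
  rw [e, e4] at h
  refine h.trans (le_of_eq ?_)
  norm_num [Nat.factorial]
  ring

/-- Taylor bound for `exp` on `[-1, 1]` to second order: `|e^y − (1 + y + y²/2)| ≤ (2/9) |y|³`. -/
theorem abs_exp_sub_taylor_two_le {y : ℝ} (hy : |y| ≤ 1) :
    |Real.exp y - (1 + y + y ^ 2 / 2)| ≤ 2 / 9 * |y| ^ 3 := by
  have h := Real.exp_bound hy (n := 3) (by norm_num)
  have e : ∑ m ∈ Finset.range 3, y ^ m / (m.factorial : ℝ) = 1 + y + y ^ 2 / 2 := by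
    simp [Finset.sum_range_succ, Nat.factorial]
  rw [e] at h
  refine h.trans (le_of_eq ?_)
  norm_num [Nat.factorial]
  ring

/-- **`k_r(x) = −½ + O(x)` at `0⁺`**: `|k_r(x) + ½| ≤ x/4` for `0 < x ≤ 1`, where
`k_r(x) = 1/x − e^{x/2}/sinh x = archResidualKernel x` is the residual archimedean kernel.  Proof:
`k_r + ½ = ((2+x) sinh x − 2x e^{x/2})/(2x sinh x)`, and the numerator `= x³/12 + O(x⁴)` is at most
`x³/2` in absolute value on `(0, 1]` by the Taylor bounds for `e^{±x}`, `e^{x/2}`.  PROVED. -/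
theorem abs_archResidualKernel_add_half_le {x : ℝ} (hx : 0 < x) (hx1 : x ≤ 1) :
    |archResidualKernel x + 1 / 2| ≤ x / 4 := by
  have hs : 0 < Real.sinh x := Real.sinh_pos_iff.2 hx
  have hxs : x ≤ Real.sinh x := Real.self_le_sinh_iff.2 hx.le
  have hk : archResidualKernel x + 1 / 2 =
      ((2 + x) * Real.sinh x - 2 * x * Real.exp (x / 2)) / (2 * x * Real.sinh x) := by
    unfold archResidualKernel
    field_simp
    ring
  -- Taylor remainders
  obtain ⟨R₁, hR₁⟩ : ∃ R : ℝ, Real.exp x = 1 + x + x ^ 2 / 2 + x ^ 3 / 6 + R :=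
    ⟨Real.exp x - (1 + x + x ^ 2 / 2 + x ^ 3 / 6), by ring⟩
  obtain ⟨R₂, hR₂⟩ : ∃ R : ℝ, Real.exp (-x) = 1 + (-x) + (-x) ^ 2 / 2 + (-x) ^ 3 / 6 + R :=
    ⟨Real.exp (-x) - (1 + (-x) + (-x) ^ 2 / 2 + (-x) ^ 3 / 6), by ring⟩
  obtain ⟨R₃, hR₃⟩ : ∃ R : ℝ, Real.exp (x / 2) = 1 + x / 2 + (x / 2) ^ 2 / 2 + R :=
    ⟨Real.exp (x / 2) - (1 + x / 2 + (x / 2) ^ 2 / 2), by ring⟩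
  have hax : |x| ≤ 1 := by rwa [abs_of_pos hx]
  have b1 : |R₁| ≤ 5 / 96 * x ^ 4 := by
    have h := abs_exp_sub_taylor_three_le hax
    rwa [hR₁, add_sub_cancel_left] at h
  have b2 : |R₂| ≤ 5 / 96 * x ^ 4 := by
    have h := abs_exp_sub_taylor_three_le (y := -x) (by rwa [abs_neg])
    rw [hR₂, add_sub_cancel_left] at h
    simpa only [neg_pow, neg_sq, even_two, Even.neg_pow] using h.trans (le_of_eq (by ring))
  have b3 : |R₃| ≤ x ^ 3 / 36 := by
    have h := abs_exp_sub_taylor_two_le (y := x / 2) (by rw [abs_of_pos (by positivity)]; linarith)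
    rw [hR₃, add_sub_cancel_left, abs_of_pos (by positivity : (0 : ℝ) < x / 2)] at h
    exact h.trans (le_of_eq (by ring))
  -- the numerator
  have hN : (2 + x) * Real.sinh x - 2 * x * Real.exp (x / 2) =
      x ^ 3 / 12 + x ^ 4 / 6 + (2 + x) * ((R₁ - R₂) / 2) - 2 * (x * R₃) := by
    rw [Real.sinh_eq, hR₁, hR₂, hR₃]; ring
  have hx4 : x ^ 4 ≤ x ^ 3 := by
    calc x ^ 4 = x ^ 3 * x := by ring
      _ ≤ x ^ 3 * 1 := by gcongr
      _ = x ^ 3 := by ring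
  obtain ⟨b1l, b1u⟩ := abs_le.1 b1
  obtain ⟨b2l, b2u⟩ := abs_le.1 b2
  obtain ⟨b3l, b3u⟩ := abs_le.1 b3
  have hNle : |(2 + x) * Real.sinh x - 2 * x * Real.exp (x / 2)| ≤ x ^ 3 / 2 := by
    rw [hN, abs_le]
    have h2x : (0 : ℝ) ≤ 2 + x := by linarith
    constructor
    · nlinarith [mul_le_mul_of_nonneg_left b3u hx.le,
        mul_nonneg h2x (by linarith : 0 ≤ (R₁ - R₂) / 2 + 5 / 96 * x ^ 4)]
    · nlinarith [mul_le_mul_of_nonneg_left b3l hx.le,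
        mul_nonneg h2x (by linarith : 0 ≤ 5 / 96 * x ^ 4 - (R₁ - R₂) / 2)]
  rw [hk, abs_div, abs_of_pos (by positivity : 0 < 2 * x * Real.sinh x),
    div_le_iff₀ (by positivity)]
  calc |(2 + x) * Real.sinh x - 2 * x * Real.exp (x / 2)| ≤ x ^ 3 / 2 := hNle
    _ = x / 4 * (2 * x * x) := by ring
    _ ≤ x / 4 * (2 * x * Real.sinh x) := by gcongr

/-- **`k_r(0⁺) = −½`**: the residual archimedean kernel tends to `−½` at `0⁺` (the value recorded
without proof in `MotivicDoorArchLogLaplacian`).  PROVED. -/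
theorem tendsto_archResidualKernel_nhdsGT_zero :
    Tendsto archResidualKernel (𝓝[>] (0 : ℝ)) (𝓝 (-(1 / 2))) := by
  rw [Metric.tendsto_nhdsWithin_nhds]
  intro ε hε
  refine ⟨min 1 ε, by positivity, fun x hx hxd ↦ ?_⟩
  have hx0 : 0 < x := hx
  rw [Real.dist_eq, sub_zero, abs_of_pos hx0] at hxd
  have hx1 : x ≤ 1 := ((lt_min_iff.1 hxd).1).le
  have hxe : x < ε := (lt_min_iff.1 hxd).2
  rw [Real.dist_eq, show archResidualKernel x - -(1 / 2) = archResidualKernel x + 1 / 2 by ring]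
  calc |archResidualKernel x + 1 / 2| ≤ x / 4 := abs_archResidualKernel_add_half_le hx0 hx1
    _ < ε := by linarith

end Kernel

/-! ## 2. The residual to second order: `½∫₀^∞ k_r(x) k(Ex) dx = −(4E)⁻¹∫₀^∞ k + O(E⁻²)` -/

section Residual

variable {F : ℝ → ℂ}

/-- `∫₀^∞ k = ∫_ℝ F` for `k = weilSymm F = F + F(−·)`, `F` integrable.  PROVED. -/
theorem integral_Ioi_weilSymm_eq_integral (hF : Integrable F) :
    ∫ x in Ioi (0 : ℝ), weilSymm F x = ∫ x, F x := by
  simp only [weilSymm]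
  rw [integral_add hF.integrableOn hF.comp_neg.integrableOn, integral_comp_neg_Ioi, neg_zero,
    add_comm, intervalIntegral.integral_Iic_add_Ioi hF.integrableOn hF.integrableOn]

/-- **The residual to second order.**  For a Weil test `F` with `supp F ⊆ [-S, S]`, `S ≤ E`,
`0 < E`,
`k = weilSymm F`: `‖½∫₀^∞ k_r(x) k(Ex) dx + (4E)⁻¹∫₀^∞ k‖ ≤ S/(8E²) · ∫₀^∞‖k‖`
(the sum equals `½∫₀^{S/E} (k_r(x) + ½) k(Ex) dx`, and `|k_r(x) + ½| ≤ x/4 ≤ S/(4E)` there).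
PROVED. -/
theorem norm_archResidual_comp_mul_add_le (hF : IsWeilTest F) {S : ℝ}
    (hsupp : tsupport F ⊆ Icc (-S) S) {E : ℝ} (hE : 0 < E) (hSE : S ≤ E) :
    ‖(1 / 2 : ℂ) * (∫ x in Ioi (0 : ℝ), (archResidualKernel x : ℂ) * weilSymm F (E * x)) +
        (1 / (4 * E) : ℂ) * ∫ x in Ioi (0 : ℝ), weilSymm F x‖ ≤
      S / (8 * E ^ 2) * ∫ x in Ioi (0 : ℝ), ‖weilSymm F x‖ := by
  set k : ℝ → ℂ := weilSymm F with hkdef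
  have hk : IsWeilTest k := hF.weilSymm
  have hkE : IsWeilTest (fun x ↦ k (E * x)) := hk.comp_mul hE.ne'
  have hintE : Integrable (fun x ↦ k (E * x)) :=
    hkE.1.continuous.integrable_of_hasCompactSupport hkE.2
  have hres : IntegrableOn (fun x : ℝ ↦ (archResidualKernel x : ℂ) * k (E * x)) (Ioi 0) := by
    have h := integrableOn_archResidualKernel_mul (hF.comp_mul hE.ne').weilSymm
    simpa only [weilSymm_comp_mul_eq] using h
  have hEc : (E : ℂ) ≠ 0 := by exact_mod_cast hE.ne'
  -- substitution `y = Ex` in `∫ k` and in `∫ ‖k‖`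
  have hsub : ∫ x in Ioi (0 : ℝ), k (E * x) = (E : ℂ)⁻¹ * ∫ x in Ioi (0 : ℝ), k x := by
    have h := integral_comp_mul_left_Ioi k 0 hE
    rw [mul_zero] at h
    rw [h, Complex.real_smul, Complex.ofReal_inv]
  have hsubn : ∫ x in Ioi (0 : ℝ), ‖k (E * x)‖ = E⁻¹ * ∫ x in Ioi (0 : ℝ), ‖k x‖ := by
    have h := integral_comp_mul_left_Ioi (fun x ↦ ‖k x‖) 0 hE
    rw [mul_zero] at h
    rw [h, smul_eq_mul]
  -- a single integral, `½ ∫ (k_r(x) + ½) k(Ex) dx`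
  have e : ∀ x : ℝ, ((archResidualKernel x + 1 / 2 : ℝ) : ℂ) * k (E * x) =
      (archResidualKernel x : ℂ) * k (E * x) + (1 / 2 : ℂ) * k (E * x) := by
    intro x; push_cast; ring
  have hsum : IntegrableOn (fun x : ℝ ↦ ((archResidualKernel x + 1 / 2 : ℝ) : ℂ) * k (E * x))
      (Ioi 0) :=
    (hres.add (hintE.integrableOn.const_mul (1 / 2 : ℂ))).congr_fun (fun x _ ↦ (e x).symm)
      measurableSet_Ioi
  have hcomb : (1 / 2 : ℂ) * (∫ x in Ioi (0 : ℝ), (archResidualKernel x : ℂ) * k (E * x)) +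
      (1 / (4 * E) : ℂ) * ∫ x in Ioi (0 : ℝ), k x =
      (1 / 2 : ℂ) * ∫ x in Ioi (0 : ℝ), ((archResidualKernel x + 1 / 2 : ℝ) : ℂ) * k (E * x) := by
    simp_rw [e]
    rw [integral_add hres (hintE.integrableOn.const_mul (1 / 2 : ℂ)), integral_const_mul, hsub]
    field_simp
    ring
  rw [hcomb, norm_mul]
  -- pointwise bound: `|k_r(x) + ½| ≤ S/(4E)` where `k(Ex) ≠ 0`
  have hpt : ∀ x ∈ Ioi (0 : ℝ),
      ‖((archResidualKernel x + 1 / 2 : ℝ) : ℂ) * k (E * x)‖ ≤ S / (4 * E) * ‖k (E * x)‖ := by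
    intro x hx
    have hx : 0 < x := hx
    rw [norm_mul, Complex.norm_real, Real.norm_eq_abs]
    by_cases hxS : E * x ≤ S
    · have hxSE : x ≤ S / E := by rw [le_div_iff₀ hE]; linarith
      have hx1 : x ≤ 1 := hxSE.trans ((div_le_one hE).2 hSE)
      refine mul_le_mul_of_nonneg_right ?_ (norm_nonneg _)
      calc |archResidualKernel x + 1 / 2| ≤ x / 4 := abs_archResidualKernel_add_half_le hx hx1
        _ ≤ S / E / 4 := by gcongr
        _ = S / (4 * E) := by ring
    · have hxS' : S < E * x := not_le.1 hxS
      have h1 : E * x ∉ tsupport F := fun h ↦ by have := (hsupp h).2; linarith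
      have h2 : -(E * x) ∉ tsupport F := fun h ↦ by have := (hsupp h).1; linarith
      have hz : k (E * x) = 0 := by
        simp only [hkdef, weilSymm, image_eq_zero_of_notMem_tsupport h1,
          image_eq_zero_of_notMem_tsupport h2, add_zero]
      simp [hz]
  have h2 : ‖∫ x in Ioi (0 : ℝ), ((archResidualKernel x + 1 / 2 : ℝ) : ℂ) * k (E * x)‖ ≤
      ∫ x in Ioi (0 : ℝ), S / (4 * E) * ‖k (E * x)‖ :=
    (norm_integral_le_integral_norm _).trans
      (setIntegral_mono_on hsum.norm (hintE.norm.const_mul _).integrableOn measurableSet_Ioi hpt)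
  rw [integral_const_mul, hsubn] at h2
  rw [show ‖(1 / 2 : ℂ)‖ = 1 / 2 by simp]
  have hI : 0 ≤ ∫ x in Ioi (0 : ℝ), ‖k x‖ := integral_nonneg fun _ ↦ norm_nonneg _
  calc 1 / 2 * ‖∫ x in Ioi (0 : ℝ), ((archResidualKernel x + 1 / 2 : ℝ) : ℂ) * k (E * x)‖
      ≤ 1 / 2 * (S / (4 * E) * (E⁻¹ * ∫ x in Ioi (0 : ℝ), ‖k x‖)) := by gcongr
    _ = S / (8 * E ^ 2) * ∫ x in Ioi (0 : ℝ), ‖k x‖ := by field_simp; ring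

/-- **The archimedean functional along dilations, to three terms**: for `supp F ⊆ [-S, S]`, `S ≤ E`,
`0 < E`, `k = weilSymm F`, `𝓔 = logLaplacianEnergy`:
`‖W_arch(F(E·)) − F(0) log E − (½𝓔(F) − log(2π)F(0)) + (4E)⁻¹∫₀^∞ k‖ ≤ S/(8E²) · ∫₀^∞‖k‖`
(`W_arch = weilArchTerm`, `= −W_ℝ` in Bombieri's sign convention).  PROVED. -/
theorem norm_weilArchTerm_comp_mul_sub_three_le (hF : IsWeilTest F) {S : ℝ}
    (hsupp : tsupport F ⊆ Icc (-S) S) {E : ℝ} (hE : 0 < E) (hSE : S ≤ E) :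
    ‖weilArchTerm (fun t ↦ F (E * t)) - F 0 * (Real.log E : ℂ) -
        ((1 / 2 : ℂ) * logLaplacianEnergy F - (Real.log (2 * Real.pi) : ℂ) * F 0) +
        (1 / (4 * E) : ℂ) * ∫ x in Ioi (0 : ℝ), weilSymm F x‖ ≤
      S / (8 * E ^ 2) * ∫ x in Ioi (0 : ℝ), ‖weilSymm F x‖ := by
  rw [weilArchTerm_comp_mul_eq_logLaplacian hF hE,
    show ∀ a b c d : ℂ, a + b + c - a - b + d = c + d from fun a b c d ↦ by ring]
  exact norm_archResidual_comp_mul_add_le hF hsupp hE hSE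

/-- `∫₀^∞ weilSymm (g ⋆ g̃) = |∫ g|²`.  PROVED. -/
theorem integral_Ioi_weilSymm_weilConv_weilReflect {g : ℝ → ℂ} (hg : IsWeilTest g) :
    ∫ x in Ioi (0 : ℝ), weilSymm (weilConv g (weilReflect g)) x = ((‖∫ t, g t‖ ^ 2 : ℝ) : ℂ) := by
  have hF : IsWeilTest (weilConv g (weilReflect g)) := hg.weilConv hg.weilReflect
  rw [integral_Ioi_weilSymm_eq_integral (hF.1.continuous.integrable_of_hasCompactSupport hF.2),
    integral_weilConv_weilReflect hg]

end Residual

end Summit.RiemannHypothesis.RiemannHypothesis.Theorems.MotivicDoor.ConnesConsani
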